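import Literature.MathematicalPhysics.QuantumLattice.InfVolFermionStateParticleHoleHubbardEnergy
import Literature.MathematicalPhysics.QuantumLattice.InfVolFermionStateParticleHolePairAmplitude
import Literature.MathematicalPhysics.QuantumLattice.DWaveOrderParameterQuasiAverageState
import HarnessLib

/-!
# Particle–hole symmetry of the Koma–Tasaki `d`-wave ORDER PARAMETER at `t' = 0`: `m⋆(U; U − μ) = m⋆(U; μ)`

Topic `MathematicalPhysics/QuantumLattice`. The staggered particle–hole automorphism `α` maps the translation-invariant
mean-energy minimisers of `H^{t,0,U} − μN` onto those of `H^{t,0,U} − (U − μ)N` (`e_{U−μ}(σ ∘ α) = e_μ(σ) + (2μ − U)` for every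
translation-invariant `σ`, `InfVolFermionStateParticleHoleHubbardEnergy`) and preserves the real part of the `d`-wave pair amplitude
(`InfVolFermionStateParticleHolePairAmplitude`). Since the quasi-average order parameter `m⋆(μ) = dWaveOrderParameterTT' 0 U μ` is the
largest `Re ω(P₀^d)` over that class (`IsMeanEnergyMinimiser.re_expect_localPairAt_le_dWaveOrderParameterTT'`,
`exists_isMeanEnergyMinimiser_two_mul_re_expect_localPairAt_eq_neg_rightDeriv`), it is SYMMETRIC about the mirror point `μ = U/2`:
**hole doping and electron doping carry the same `d`-wave order parameter at `t' = 0`** — the order-parameter form of the Lieb–Wu /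
Essler particle–hole dictionary `e(n) = e(2 − n) + U(n − 1)` (`HubbardNNNHoppingEnergyDensityParticleHole`). Everything PROVED; no definition.

* `IsTranslationInvariant.meanEnergy_hubbardTTPrimeMu_particleHole_sub` — `e_{U−μ}(σ ∘ α) = e_μ(σ) + (2μ − U)`;
* `IsMeanEnergyMinimiser.particleHole_sub` — minimisers at `μ` ↦ minimisers at `U − μ` (general `μ`; `μ = U/2` is
  `IsMeanEnergyMinimiser.particleHole_halfCoupling`);
* `dWaveOrderParameterTT'_zero_sub_le` / **`dWaveOrderParameterTT'_zero_particleHole`**: `dWaveOrderParameterTT' 0 U (U − μ) = dWaveOrderParameterTT' 0 U μ`.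

References: E. H. Lieb, PRL 62 (1989) 1201, proof of Thm 2 [LiebPRL1989]; E. H. Lieb, F. Y. Wu, Physica A 321 (2003) 1, §1 eq. (3)
[LiebWuPhysicaA2003]; T. Koma, H. Tasaki, J. Stat. Phys. 76 (1994) 745, §1 [KomaTasaki1994]; F. H. L. Essler et al. (2005) §2.2.4 [EsslerEtAl2005].
-/

noncomputable section

namespace Literature.MathematicalPhysics.QuantumLattice

open Matrix Finset HubbardWave0 Literature.Probability.LatticeModels ThermodynamicLimit Set
open scoped ComplexOrder BigOperators

namespace InfVolFermionState

variable {ω : InfVolFermionState 2} (t U μ : ℝ)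

/-- **`e_{U−μ}(σ ∘ α) = e_μ(σ) + (2μ − U)`** for translation-invariant `σ` (`t' = 0`). [cite: LiebPRL1989, proof of Theorem 2]
[cite: LiebWuPhysicaA2003, §1 eq. (3)] -/
theorem IsTranslationInvariant.meanEnergy_hubbardTTPrimeMu_particleHole_sub (hω : ω.IsTranslationInvariant) :
    ω.particleHole.meanEnergy (hubbardTTPrimeMuInteraction t 0 U (U - μ)) 1 =
      ω.meanEnergy (hubbardTTPrimeMuInteraction t 0 U μ) 1 + (2 * μ - U) := by
  rw [meanEnergy_hubbardTTPrimeMu, meanEnergy_hubbardTTPrimeMu, hω.meanEnergy_hubbardTTPrime_zero_particleHole,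
    density_particleHole]
  ring

/-- **Minimisers at `μ` are mapped to minimisers at `U − μ`** (`t' = 0`; the involution `α` preserves translation invariance of
the even = translation-invariant states and shifts every pencil mean energy by the same constant).
[cite: LiebPRL1989, proof of Theorem 2] [cite: BratteliKishimotoRobinson1978, Thm. 2 (condition 2)] -/
theorem IsMeanEnergyMinimiser.particleHole_sub (h : ω.IsMeanEnergyMinimiser (hubbardTTPrimeMuInteraction t 0 U μ) 1) :
    ω.particleHole.IsMeanEnergyMinimiser (hubbardTTPrimeMuInteraction t 0 U (U - μ)) 1 := by
  refine ⟨h.1.particleHole (h.1.isEven two_pos), fun ω' hω' => ?_⟩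
  have hω'ph : ω'.particleHole.IsTranslationInvariant := hω'.particleHole (hω'.isEven two_pos)
  have h2 := h.2 ω'.particleHole hω'ph
  have key := hω'ph.meanEnergy_hubbardTTPrimeMu_particleHole_sub t U μ
  rw [particleHole_particleHole] at key
  rw [h.1.meanEnergy_hubbardTTPrimeMu_particleHole_sub, key]
  linarith

end InfVolFermionState

/-! ### The order parameter -/

section OrderParameter

variable (U μ : ℝ)

/-- `m⋆(0, U; μ) ≤ m⋆(0, U; U − μ)`: the maximising ground state at `μ` is carried to a ground state at `U − μ` with the same
`Re ω(P₀^d)`. [cite: KomaTasaki1994, §1] [cite: LiebPRL1989, proof of Theorem 2] -/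
theorem dWaveOrderParameterTT'_zero_le_sub : dWaveOrderParameterTT' 0 U μ ≤ dWaveOrderParameterTT' 0 U (U - μ) := by
  obtain ⟨ω, hω, hωe⟩ := exists_isMeanEnergyMinimiser_two_mul_re_expect_localPairAt_eq_neg_rightDeriv 0 U μ 0
  have hmin : ω.IsMeanEnergyMinimiser (hubbardTTPrimeMuInteraction 1 0 U μ) 1 := by
    rw [← hubbardTTPrimeSourcedInteraction_zero_source 1 0 U μ dWaveFormFactor]; exact hω
  have hph := hmin.particleHole_sub 1 U μ
  have hle := hph.re_expect_localPairAt_le_dWaveOrderParameterTT'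
  rw [ω.re_particleHole_expect_localPairAt_dWave] at hle
  rw [dWaveOrderParameterTT'_eq_neg_half_rightDeriv]
  linarith

/-- **PARTICLE–HOLE SYMMETRY OF THE `d`-WAVE ORDER PARAMETER at `t' = 0`: `m⋆(0, U; U − μ) = m⋆(0, U; μ)`** — the electron-doped
side `μ > U/2` carries the same Koma–Tasaki quasi-average `d`-wave order parameter as the hole-doped side; any certified ceiling on one
side is a ceiling on the other. [cite: KomaTasaki1994, §1] [cite: LiebWuPhysicaA2003, §1 eq. (3)] [cite: EsslerEtAl2005, §2.2.4] -/
theorem dWaveOrderParameterTT'_zero_particleHole : dWaveOrderParameterTT' 0 U (U - μ) = dWaveOrderParameterTT' 0 U μ := by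
  refine le_antisymm ?_ (dWaveOrderParameterTT'_zero_le_sub U μ)
  have h := dWaveOrderParameterTT'_zero_le_sub U (U - μ)
  rwa [sub_sub_cancel] at h

end OrderParameter

end Literature.MathematicalPhysics.QuantumLattice

end
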